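import Summits.BirchSwinnertonDyer.BirchSwinnertonDyer.Theorems.ResidualThetaTransportAtTwoResidualSignedLambdaLowerCMAtTwoRhoLayerPairingProjection
import Summits.BirchSwinnertonDyer.BirchSwinnertonDyer.Theorems.ResidualThetaTransportAtTwoResidualSignedLambdaLowerCMAtTwoDeepHalfAwayTwoCharacterReadback
import Summits.BirchSwinnertonDyer.BirchSwinnertonDyer.Theorems.ResidualThetaTransportAtTwoResidualSignedLambdaLowerCMAtTwoCosetFrameOdd
import Summits.BirchSwinnertonDyer.BirchSwinnertonDyer.Theorems.ResidualThetaTransportAtTwoResidualSignedLambdaLowerCMAtTwoRhoLayerPairingGlueAwayTwo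
import Literature.NumberTheory.GaloisRepresentations.ContinuousShapiroLiftMackeyH1Equiv
import HarnessLib

/-!
# (T2): the character-built local classes are compatible along Kato's trace `Maps(Γ ⧸ Γ_{n+1}, ·) → Maps(Γ ⧸ Γ_n, ·)` — the hypothesis `hT2`
# of `AwayAssembly.exists_iwasawaH1_locdS_eq_of_towerCompat`, for `n ≥ n_w`

Route `ResidualThetaTransportAtTwo` (RTT), crux RSL_g `ResidualSignedLambdaLowerCMAtTwo` (stmt-BirchSwinnertonDyer-22608), stub S4₀ `stub_deepHalfAwayTwo`;
seat `prover-bsd-wall-tp2-p2x` g19 (`--supports 22608 --as helper`, closes nothing). THEOREMS ONLY (no definition, no named fact, no instance,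
no notation, no `sorry`). BSD is not proved by any of this; RSL_g is not proved here.

WHAT. For a place `w ∤ 2` with splitting level `n_w = nfl w` and a level `n ≥ n_w`, the Mackey frame `Cosets κ w × (Γ_w ⧸ U_n) ≃ Γ ⧸ Γ_n`
(`CosetFrame.bijective_cosets_out`) is the SAME index set at levels `n` and `n + 1`; along it Kato's trace (the fibre sum `coindFinSum` on
`Maps(Γ ⧸ Γ_{n+1}, M)`, restricted to `Γ_w`) acts componentwise as the LOCAL fibre sum `Maps(Γ_w ⧸ U_{n+1}, M) → Maps(Γ_w ⧸ U_n, M)`, i.e. as the local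
corestriction under Shapiro. Hence local classes whose components read ONE character of `D_w` at layers `n + 1` and `n` are trace-compatible.
* §1 (generic coefficients) **`layerPairingH1Of_coresLe`** — the projection formula at layer level: `⟨cor b', y⟩_n = ⟨b', res y⟩_{n+1}`
  (`cohomologyMap_coindFinSum_shapiroLift`, `ContPairing.cupProduct_coindFinSum_left`, `cohomologyMap_coindFinRes_shapiroLift`, exactly as in
  `layerPairingOf_layerCores`).
* §2 `fibre_iff`, **`resCoindFinHomR_coindFinSum`** — the component identity `Φ^n_{σ_c}(Σ F) = Σ^{loc}(Φ^{n+1}_{σ_c} F)` for `n ≥ n_w` (fibres of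
  `Γ ⧸ Γ_{n+1} → Γ ⧸ Γ_n` over the orbit of `σ_c` correspond to fibres of `Γ_w ⧸ U_{n+1} → Γ_w ⧸ U_n` under the frame).
* §3 (`p = 2`, the S₀-frame) `coresLe_eq_of_characters` — `cor (b₁ c) = b₀ c` (uniqueness `existsUnique_dlev_of_character`, §1, `jAway_resLe_succ`);
  **`cohomologyMap_eq_of_characters_of_sum`** (abstract trace morphism) and **`cohomologyMap_coindSum_eq_of_characters`** — THE HYPOTHESIS `hT2` (for
  `n ≥ n_w`) in the verbatim currency of p704576.

NOTE (scope): below the splitting level (`n + 1 ≤ n_w`) the statement `hT2` of p704576 is NOT a consequence of the character hypotheses (two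
level-`n+1` orbits merge into one level-`n` orbit); the assembly only ever uses `n ≥ N₀ ≥ n_w`, and the version of the assembly consuming the present
theorem carries the hypothesis `n_w ≤ n` (landed separately).

References: [NeukirchSchmidtWingberg2008] I §5 (1.5.3)(iv), (1.5.6)–(1.5.7), I §6 (1.6.4); [Kobayashi2003] (8.23); [PerrinRiou1994Invent] §3.6.1;
[Kato2004Asterisque] §12.2 (p. 220), §13.8 (p. 228); [Washington1997] §13.1.
-/

set_option autoImplicit false
-- the Theorems namespace of this sub repeats the summit name by design (D-0017 nested layout)
set_option linter.dupNamespace false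

noncomputable section

open scoped Classical

namespace Summit.BirchSwinnertonDyer.BirchSwinnertonDyer.Theorems

namespace ThetaTransport.AwayTowerCores

open CategoryTheory Function Field NumberField IsDedekindDomain
  Literature.NumberTheory.EllipticCurves Literature.NumberTheory.EllipticCurves.CyclotomicLayer
  Literature.NumberTheory.EllipticCurves.GreenbergSelmer
  Literature.NumberTheory.GaloisRepresentations Literature.NumberTheory.GaloisRepresentations.DiscreteGaloisModule
  Literature.NumberTheory.GaloisCohomology ZpExtension
  ThetaTransport.AwayCharacterReadback Summit.BirchSwinnertonDyer.BirchSwinnertonDyer.Theorems.OnePair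

attribute [local instance] absoluteGaloisGroup_compactSpace

/-! ## §1 The projection formula at layer level: `⟨cor b', y⟩_n = ⟨b', res y⟩_{n+1}` -/

section Generic

variable {p : ℕ} [Fact p.Prime] {M : Type} [AddCommGroup M] [TopologicalSpace M] [DiscreteTopology M]
  (ρM : DiscreteGaloisModule ℚ M) (N : ℕ) [NeZero N]
  (e : M → M → AlgebraicClosure ℚ)
  (hμ : ∀ S T, e S T ^ N = 1)
  (hadd₁ : ∀ S₁ S₂ T, e (S₁ + S₂) T = e S₁ T * e S₂ T)
  (hadd₂ : ∀ S T₁ T₂, e S (T₁ + T₂) = e S T₁ * e S T₂)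
  (hgal : ∀ (σ : absoluteGaloisGroup ℚ) (S T : M), σ • e S T = e (ρM σ S) (ρM σ T))
  (κ : ZpExtension ℚ p) (v : HeightOneSpectrum (𝓞 ℚ))

/-- **The projection formula at layer level**: for `b' ∈ H¹(U_{n+1}, M|)` and `y ∈ H¹(U_n, M|)`,
`⟨cor_{U_{n+1}}^{U_n} b', y⟩_{n,N} = ⟨b', res_{U_{n+1}}^{U_n} y⟩_{n+1,N}` — Shapiro carries `cor` to the fibre sum (`cohomologyMap_coindFinSum_shapiroLift`), which
is adjoint to the pull-back (`ContPairing.cupProduct_coindFinSum_left`), which Shapiro carries to `res` (`cohomologyMap_coindFinRes_shapiroLift`); cf.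
`layerPairingOf_layerCores`. [cite: NeukirchSchmidtWingberg2008, I §5 Prop. (1.5.3)(iv)] [cite: Kobayashi2003, (8.23) (p. 18)] -/
theorem layerPairingH1Of_coresLe (n : ℕ) [Fintype (layerGroup κ v n ⧸ (layerGroup κ v (n + 1)).subgroupOf (layerGroup κ v n))]
    (b' : continuousCohomology 1 (subgroupRep (localRepOf ρM v) (layerGroup κ v (n + 1))))
    (y : continuousCohomology 1 (subgroupRep (localRepOf ρM v) (layerGroup κ v n))) :
    layerPairingH1Of ρM N e hμ hadd₁ hadd₂ hgal κ v n
        (coresLe (localRepOf ρM v) (SignedKatoOffTwo.LayerPairing.layerGroup_antitone κ v n) (isOpen_layerGroup κ v (n + 1)) b') y =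
      layerPairingH1Of ρM N e hμ hadd₁ hadd₂ hgal κ v (n + 1) b'
        (resLe (localRepOf ρM v) (SignedKatoOffTwo.LayerPairing.layerGroup_antitone κ v n) 1 y) := by
  letI : Fintype (absoluteGaloisGroup (v.adicCompletion ℚ) ⧸ layerGroup κ v n) := layerFintypeQuot κ v n
  letI : Fintype (absoluteGaloisGroup (v.adicCompletion ℚ) ⧸ layerGroup κ v (n + 1)) := layerFintypeQuot κ v (n + 1)
  rw [layerPairingH1Of_apply, layerPairingH1Of_apply]
  unfold layerShapiroOf layerSumPairingOf
  rw [← cohomologyMap_coindFinSum_shapiroLift (localRepOf ρM v) (SignedKatoOffTwo.LayerPairing.layerGroup_antitone κ v n)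
      (isOpen_layerGroup κ v n) (isOpen_layerGroup κ v (n + 1)) (layerReps_spec κ v n) (layerReps_one κ v n) (layerReps_spec κ v (n + 1))
      (layerReps_one κ v (n + 1)),
    ← cohomologyMap_id_muLocalRep' N v (ContPairing.cupProduct _ _ _),
    ContPairing.cupProduct_coindFinSum_left,
    cohomologyMap_coindFinRes_shapiroLift (localRepOf ρM v) (SignedKatoOffTwo.LayerPairing.layerGroup_antitone κ v n)
      (isOpen_layerGroup κ v n) (isOpen_layerGroup κ v (n + 1)) (layerReps_spec κ v n) (layerReps_one κ v n) (layerReps_spec κ v (n + 1))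
      (layerReps_one κ v (n + 1))]

end Generic

/-! ## §2 The component identity `Φ^n_{σ_c} ∘ Σ = Σ^{loc} ∘ Φ^{n+1}_{σ_c}` for `n ≥ n_w` -/

section Frame

variable (κ : ZpExtension ℚ 2) (hκ : κ.IsCyclotomic) (w : HeightOneSpectrum (𝓞 ℚ)) (hw : ((2 : ℕ) : 𝓞 ℚ) ∉ w.asIdeal)

/-- The level maps commute with the frame: `π_Γ(ē_{n+1}(x'')·σ Γ_{n+1}) = ē_n(π_U x'')·σ Γ_n`. [cite: Brown1982, III §5 (5.6)(b)] -/
theorem quotientMapOfLE_quotientMapOfHom_mul (n : ℕ) (σ : absoluteGaloisGroup ℚ)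
    (x'' : absoluteGaloisGroup (w.adicCompletion ℚ) ⧸ layerGroup κ w (n + 1)) :
    Subgroup.quotientMapOfLE (κ.layerSubgroup_antitone (Nat.le_succ n))
        (quotientMapOfHom (κ.layerSubgroup (n + 1)) (resGalOfEmb (closureEmb (K := ℚ) (w.adicCompletion ℚ))) x'' *
          (σ : absoluteGaloisGroup ℚ ⧸ κ.layerSubgroup (n + 1))) =
      quotientMapOfHom (κ.layerSubgroup n) (resGalOfEmb (closureEmb (K := ℚ) (w.adicCompletion ℚ)))
          (Subgroup.quotientMapOfLE (SignedKatoOffTwo.LayerPairing.layerGroup_antitone κ w n) x'') *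
        (σ : absoluteGaloisGroup ℚ ⧸ κ.layerSubgroup n) := by
  induction x'' using QuotientGroup.induction_on with
  | H d => rfl

include hκ hw in
/-- **The fibre condition in frame coordinates.** For `n ≥ n_w`, `x' ∈ Γ_w ⧸ U_n` and a frame point `(c', x'')` at level `n + 1`:
`π_Γ(ē_{n+1}(x'')·σ_{c'}Γ_{n+1}) = ē_n(x')·σ_cΓ_n` iff `c' = c` and `π_U x'' = x'` (frame injectivity at level `n`).
[cite: NeukirchSchmidtWingberg2008, I §5 (1.5.6)–(1.5.7)] [cite: Washington1997, §13.1] -/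
theorem fibre_iff {n : ℕ} (hn : nfl w ≤ n) (c c' : Cosets κ w) (x' : absoluteGaloisGroup (w.adicCompletion ℚ) ⧸ layerGroup κ w n)
    (x'' : absoluteGaloisGroup (w.adicCompletion ℚ) ⧸ layerGroup κ w (n + 1)) :
    Subgroup.quotientMapOfLE (κ.layerSubgroup_antitone (Nat.le_succ n))
          (quotientMapOfHom (κ.layerSubgroup (n + 1)) (resGalOfEmb (closureEmb (K := ℚ) (w.adicCompletion ℚ))) x'' *
            (c'.out : absoluteGaloisGroup ℚ ⧸ κ.layerSubgroup (n + 1))) =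
        quotientMapOfHom (κ.layerSubgroup n) (resGalOfEmb (closureEmb (K := ℚ) (w.adicCompletion ℚ))) x' *
          (c.out : absoluteGaloisGroup ℚ ⧸ κ.layerSubgroup n) ↔
      c' = c ∧ Subgroup.quotientMapOfLE (SignedKatoOffTwo.LayerPairing.layerGroup_antitone κ w n) x'' = x' := by
  constructor
  · intro h
    have key := (CosetFrame.bijective_cosets_out κ hκ w hw hn).1
      (a₁ := (c', Subgroup.quotientMapOfLE (SignedKatoOffTwo.LayerPairing.layerGroup_antitone κ w n) x'')) (a₂ := (c, x'))
      ((quotientMapOfLE_quotientMapOfHom_mul κ w n c'.out x'').symm.trans h)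
    exact ⟨(Prod.mk.inj key).1, (Prod.mk.inj key).2⟩
  · rintro ⟨rfl, rfl⟩
    exact quotientMapOfLE_quotientMapOfHom_mul κ w n c'.out x''

include hκ hw in
/-- **`Φ^n_{σ_c}(Σ F) = Σ^{loc}(Φ^{n+1}_{σ_c} F)`** for `n ≥ n_w`, `F ∈ Maps(Γ ⧸ Γ_{n+1}, X)`: Kato's trace (the fibre sum along `Γ ⧸ Γ_{n+1} → Γ ⧸ Γ_n`), read on
the `σ_c`-component, is the local fibre sum along `Γ_w ⧸ U_{n+1} → Γ_w ⧸ U_n` (reindex the fibre sum along the frame `CosetFrame.bijective_cosets_out` at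
level `n + 1` and use the fibre condition `fibre_iff`). [cite: NeukirchSchmidtWingberg2008, I §5 (1.5.6)–(1.5.7)] [cite: Kato2004Asterisque, §12.2 (p. 220)] -/
theorem resCoindFinHomR_coindFinSum {n : ℕ} (hn : nfl w ≤ n) [Fintype (absoluteGaloisGroup ℚ ⧸ κ.layerSubgroup n)]
    [Fintype (absoluteGaloisGroup ℚ ⧸ κ.layerSubgroup (n + 1))]
    [Fintype (absoluteGaloisGroup (w.adicCompletion ℚ) ⧸ layerGroup κ w n)]
    [Fintype (absoluteGaloisGroup (w.adicCompletion ℚ) ⧸ layerGroup κ w (n + 1))]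
    (X : TopRep.{0} ℤ (absoluteGaloisGroup ℚ)) (F : coindFin X (κ.layerSubgroup (n + 1))) (c : Cosets κ w)
    (x' : absoluteGaloisGroup (w.adicCompletion ℚ) ⧸ layerGroup κ w n) :
    (resCoindFinHomR X (κ.layerSubgroup n) (resGalOfEmb (closureEmb (K := ℚ) (w.adicCompletion ℚ)))
          (c.out : absoluteGaloisGroup ℚ ⧸ κ.layerSubgroup n)).hom
        ((coindFinSum X (κ.layerSubgroup_antitone (Nat.le_succ n))).hom F) x' =
      ((coindFinSum (TopRep.res (resGalOfEmb (closureEmb (K := ℚ) (w.adicCompletion ℚ)) :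
            absoluteGaloisGroup (w.adicCompletion ℚ) →* absoluteGaloisGroup ℚ) X)
          (SignedKatoOffTwo.LayerPairing.layerGroup_antitone κ w n) :
          coindFin (TopRep.res (resGalOfEmb (closureEmb (K := ℚ) (w.adicCompletion ℚ)) :
              absoluteGaloisGroup (w.adicCompletion ℚ) →* absoluteGaloisGroup ℚ) X) (layerGroup κ w (n + 1)) ⟶
            coindFin (TopRep.res (resGalOfEmb (closureEmb (K := ℚ) (w.adicCompletion ℚ)) :
              absoluteGaloisGroup (w.adicCompletion ℚ) →* absoluteGaloisGroup ℚ) X) (layerGroup κ w n)).hom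
        ((resCoindFinHomR X (κ.layerSubgroup (n + 1)) (resGalOfEmb (closureEmb (K := ℚ) (w.adicCompletion ℚ)))
          (c.out : absoluteGaloisGroup ℚ ⧸ κ.layerSubgroup (n + 1))).hom F) x') := by
  haveI : Fintype (Cosets κ w) := Fintype.ofFinite _
  have hbij₁ := CosetFrame.bijective_cosets_out κ hκ w hw (n := n + 1) (hn.trans (Nat.le_succ n))
  rw [resCoindFinHomR_apply, coindFinSum_apply, coindFinSum_apply, ← (Equiv.ofBijective _ hbij₁).sum_comp, Fintype.sum_prod_type,
    Finset.sum_comm]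
  refine Finset.sum_congr rfl fun x'' _ => ?_
  simp only [Equiv.ofBijective_apply]
  rw [Finset.sum_congr rfl fun (c' : Cosets κ w) _ => if_congr (fibre_iff κ hκ w hw hn c c' x' x'') rfl rfl,
    Finset.sum_eq_single c (fun c' _ hc' => if_neg fun h => hc' h.1) (fun h => absurd (Finset.mem_univ c) h)]
  refine if_congr (by rw [eq_self_iff_true, true_and]) rfl rfl

end Frame

/-! ## §3 (`p = 2`, the S₀-frame): `cor (b₁ c) = b₀ c` and the hypothesis `hT2` of p704576 for `n ≥ n_w` -/

section Two

variable (S : Set (PadicAlgCl 2)) (ρ : FramedGaloisRep ℚ ↥(padicCoeffIntegers S) 2)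
  (ePk : ∀ k : ℕ, ↥(AddSubgroup.torsionBy (Cofree ρ ↥(padicCoeffField S)) ((2 ^ k : ℕ) : ℤ)) →
    ↥(AddSubgroup.torsionBy (Cofree ρ ↥(padicCoeffField S)) ((2 ^ k : ℕ) : ℤ)) → AlgebraicClosure ℚ)
  (hμPk : ∀ k a b, ePk k a b ^ (2 ^ k) = 1)
  (hadd₁Pk : ∀ k a₁ a₂ b, ePk k (a₁ + a₂) b = ePk k a₁ b * ePk k a₂ b)
  (hadd₂Pk : ∀ k a b₁ b₂, ePk k a (b₁ + b₂) = ePk k a b₁ * ePk k a b₂)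
  (hgalPk : ∀ k (σ : absoluteGaloisGroup ℚ) (a b : ↥(AddSubgroup.torsionBy (Cofree ρ ↥(padicCoeffField S)) ((2 ^ k : ℕ) : ℤ))),
    σ • ePk k a b = ePk k (cofreeTorsionGaloisModule S ρ _ σ a) (cofreeTorsionGaloisModule S ρ _ σ b))
  (hnondeg : ∀ k T, (∀ a, ePk k a T = 1) → T = 0)
  (κ : ZpExtension ℚ 2) (hκ : κ.IsCyclotomic) (w : HeightOneSpectrum (𝓞 ℚ)) (hw : ((2 : ℕ) : 𝓞 ℚ) ∉ w.asIdeal)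

include hnondeg in
set_option maxHeartbeats 1600000 in
/-- **`cor (b₁ c) = b₀ c`**: if `b₁(c) ∈ H¹(U_{n+1}, A_ρ[2^k]|)` and `b₀(c) ∈ H¹(U_n, A_ρ[2^k]|)` both read the character `χ_c` of `D_w` (through `j_{n+1,k}`,
resp. `j_{n,k}`), then `cor_{U_{n+1}}^{U_n} b₁(c) = b₀(c)` — uniqueness in `existsUnique_dlev_of_character`, §1, `jAway_resLe_succ`.
[cite: PerrinRiou1994Invent, §3.6.1] [cite: Kobayashi2003, (8.23) (p. 18)] -/
theorem coresLe_eq_of_characters (n k : ℕ) [Fintype (absoluteGaloisGroup ℚ ⧸ κ.layerSubgroup n)]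
    [Fintype (layerGroup κ w n ⧸ (layerGroup κ w (n + 1)).subgroupOf (layerGroup κ w n))]
    [Finite ↥(AddSubgroup.torsionBy (Cofree ρ ↥(padicCoeffField S)) ((2 ^ k : ℕ) : ℤ))]
    (χ : Cosets κ w → CharacterModule (Dloc S κ ρ w))
    (b₁ : Cosets κ w → Dlev S κ ρ w (n + 1) k) (b₀ : Cosets κ w → Dlev S κ ρ w n k)
    (hb₁ : ∀ (c : Cosets κ w) (y : Dlev S κ ρ w (n + 1) k),
      χ c (jAway S κ ρ w (n + 1) k y) =
        (layerPairingH1Of (cofreeTorsionGaloisModule S ρ ((2 ^ k : ℕ) : ℤ)) (2 ^ k) (ePk k) (hμPk k) (hadd₁Pk k) (hadd₂Pk k) (hgalPk k)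
            κ w (n + 1) (b₁ c) y).val • ((((2 : ℚ) ^ k)⁻¹ : ℚ) : AddCircle (1 : ℚ)))
    (hb₀ : ∀ (c : Cosets κ w) (y : Dlev S κ ρ w n k),
      χ c (jAway S κ ρ w n k y) =
        (layerPairingH1Of (cofreeTorsionGaloisModule S ρ ((2 ^ k : ℕ) : ℤ)) (2 ^ k) (ePk k) (hμPk k) (hadd₁Pk k) (hadd₂Pk k) (hgalPk k)
            κ w n (b₀ c) y).val • ((((2 : ℚ) ^ k)⁻¹ : ℚ) : AddCircle (1 : ℚ)))
    (c : Cosets κ w) :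
    coresLe (localRepOf (cofreeTorsionGaloisModule S ρ ((2 ^ k : ℕ) : ℤ)) w) (SignedKatoOffTwo.LayerPairing.layerGroup_antitone κ w n)
        (isOpen_layerGroup κ w (n + 1)) (b₁ c) = b₀ c := by
  haveI : NeZero (2 ^ k) := ⟨pow_ne_zero k two_ne_zero⟩
  refine (existsUnique_dlev_of_character S ρ ePk hμPk hadd₁Pk hadd₂Pk hgalPk hnondeg κ w n k (χ c)).unique (fun y => ?_) (hb₀ c)
  rw [layerPairingH1Of_coresLe, ← hb₁ c, jAway_resLe_succ]

/-- Mackey injectivity in `ext` form (as in `…DeepHalfAwayTwoTowerPow`): two classes with the same Mackey components over a frame are equal.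
[cite: NeukirchSchmidtWingberg2008, I §5 (1.5.6)–(1.5.7)] -/
theorem eq_of_forall_component_eq {G D : Type} [Group G] [TopologicalSpace G] [Group D] [TopologicalSpace D]
    [IsTopologicalGroup D] (X : TopRep.{0} ℤ G) (N : Subgroup G) [N.Normal] (θ : D →ₜ* G) {ι : Type} (c : ι → G ⧸ N)
    (hbij : Function.Bijective fun q : ι × (D ⧸ N.comap (θ : D →* G)) => quotientMapOfHom N θ q.2 * c q.1)
    (z z' : continuousCohomology.{0, 0, 0} 1 (TopRep.res (θ : D →* G) (coindFin X N)))
    (h : ∀ i, cohomologyMap (resCoindFinHomR X N θ (c i)) 1 z = cohomologyMap (resCoindFinHomR X N θ (c i)) 1 z') : z = z' :=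
  (mackeyCohomologyEquiv X N θ c hbij).injective (funext fun i => by rw [mackeyCohomologyEquiv_apply, mackeyCohomologyEquiv_apply, h i])

include hnondeg hκ hw in
set_option maxHeartbeats 3200000 in
/-- **(T2), abstract form, `n ≥ n_w`.** For ANY morphism `P : Maps(Γ ⧸ Γ_{n+1}, A_ρ[2^k])|_{Γ_w} ⟶ Maps(Γ ⧸ Γ_n, A_ρ[2^k])|_{Γ_w}` acting as Kato's trace
(`hP`): if `t₁`, `t₀` have Mackey components `Φ^{n+1}_{σ_c}(t₁) = Sh_{n+1}(b₁ c)`, `Φ^n_{σ_c}(t₀) = Sh_n(b₀ c)` with `b₁(c)`, `b₀(c)` reading the SAME character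
`χ_c` of `D_w` at layers `n + 1`, `n`, then `P_* t₁ = t₀`: componentwise `Φ^n_{σ_c}(P_* t₁) = Σ^{loc}_* Φ^{n+1}_{σ_c}(t₁) = Σ^{loc}_* Sh_{n+1}(b₁ c) =
Sh_n(cor b₁ c) = Sh_n(b₀ c) = Φ^n_{σ_c}(t₀)` (§2, `cohomologyMap_coindFinSum_shapiroLift`, §3), and the components over the frame
`CosetFrame.bijective_cosets_out` detect classes. [cite: NeukirchSchmidtWingberg2008, I §5 (1.5.6)–(1.5.7), I §6 (1.6.4)] [cite: Kato2004Asterisque, §12.2 (p. 220)]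
[cite: PerrinRiou1994Invent, §3.6.1] -/
theorem cohomologyMap_eq_of_characters_of_sum {n : ℕ} (hn : nfl w ≤ n) (k : ℕ) [Fintype (absoluteGaloisGroup ℚ ⧸ κ.layerSubgroup n)]
    [Fintype (absoluteGaloisGroup ℚ ⧸ κ.layerSubgroup (n + 1))]
    [Finite ↥(AddSubgroup.torsionBy (Cofree ρ ↥(padicCoeffField S)) ((2 ^ k : ℕ) : ℤ))]
    (χ : Cosets κ w → CharacterModule (Dloc S κ ρ w))
    (P : (((cofreeTorsionGaloisModule S ρ ((2 ^ k : ℕ) : ℤ)).coind (κ.layerSubgroup (n + 1)) (κ.isOpen_layerSubgroup (n + 1))).toLocal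
          (Sum.inr w)).toTopRep ⟶
        (((cofreeTorsionGaloisModule S ρ ((2 ^ k : ℕ) : ℤ)).coind (κ.layerSubgroup n) (κ.isOpen_layerSubgroup n)).toLocal
          (Sum.inr w)).toTopRep)
    (hP : ∀ (F : coindFin (cofreeTorsionGaloisModule S ρ ((2 ^ k : ℕ) : ℤ)).toTopRep (κ.layerSubgroup (n + 1)))
      (y : absoluteGaloisGroup ℚ ⧸ κ.layerSubgroup n),
      P.hom F y = (coindFinSum (cofreeTorsionGaloisModule S ρ ((2 ^ k : ℕ) : ℤ)).toTopRep (κ.layerSubgroup_antitone (Nat.le_succ n))).hom F y)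
    (b₁ : Cosets κ w → Dlev S κ ρ w (n + 1) k)
    (t₁ : galoisCohomology
      (((cofreeTorsionGaloisModule S ρ ((2 ^ k : ℕ) : ℤ)).coind (κ.layerSubgroup (n + 1)) (κ.isOpen_layerSubgroup (n + 1))).toLocal
        (Sum.inr w)) 1)
    (b₀ : Cosets κ w → Dlev S κ ρ w n k)
    (t₀ : galoisCohomology
      (((cofreeTorsionGaloisModule S ρ ((2 ^ k : ℕ) : ℤ)).coind (κ.layerSubgroup n) (κ.isOpen_layerSubgroup n)).toLocal
        (Sum.inr w)) 1)
    (hb₁ : ∀ (c : Cosets κ w) (y : Dlev S κ ρ w (n + 1) k),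
      χ c (jAway S κ ρ w (n + 1) k y) =
        (layerPairingH1Of (cofreeTorsionGaloisModule S ρ ((2 ^ k : ℕ) : ℤ)) (2 ^ k) (ePk k) (hμPk k) (hadd₁Pk k) (hadd₂Pk k) (hgalPk k)
            κ w (n + 1) (b₁ c) y).val • ((((2 : ℚ) ^ k)⁻¹ : ℚ) : AddCircle (1 : ℚ)))
    (hu₁ : ∀ c : Cosets κ w,
      cohomologyMap (resCoindFinHomR (cofreeTorsionGaloisModule S ρ ((2 ^ k : ℕ) : ℤ)).toTopRep (κ.layerSubgroup (n + 1))
          (resGalOfEmb (closureEmb (K := ℚ) (w.adicCompletion ℚ)))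
          (c.out : absoluteGaloisGroup ℚ ⧸ κ.layerSubgroup (n + 1))) 1 t₁ =
        layerShapiroOf (cofreeTorsionGaloisModule S ρ ((2 ^ k : ℕ) : ℤ)) κ w (n + 1) (b₁ c))
    (hb₀ : ∀ (c : Cosets κ w) (y : Dlev S κ ρ w n k),
      χ c (jAway S κ ρ w n k y) =
        (layerPairingH1Of (cofreeTorsionGaloisModule S ρ ((2 ^ k : ℕ) : ℤ)) (2 ^ k) (ePk k) (hμPk k) (hadd₁Pk k) (hadd₂Pk k) (hgalPk k)
            κ w n (b₀ c) y).val • ((((2 : ℚ) ^ k)⁻¹ : ℚ) : AddCircle (1 : ℚ)))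
    (hu₀ : ∀ c : Cosets κ w,
      cohomologyMap (resCoindFinHomR (cofreeTorsionGaloisModule S ρ ((2 ^ k : ℕ) : ℤ)).toTopRep (κ.layerSubgroup n)
          (resGalOfEmb (closureEmb (K := ℚ) (w.adicCompletion ℚ)))
          (c.out : absoluteGaloisGroup ℚ ⧸ κ.layerSubgroup n)) 1 t₀ =
        layerShapiroOf (cofreeTorsionGaloisModule S ρ ((2 ^ k : ℕ) : ℤ)) κ w n (b₀ c)) :
    cohomologyMap P 1 t₁ = t₀ := by
  haveI : NeZero (2 ^ k) := ⟨pow_ne_zero k two_ne_zero⟩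
  letI : Fintype (absoluteGaloisGroup (w.adicCompletion ℚ) ⧸ layerGroup κ w n) := layerFintypeQuot κ w n
  letI : Fintype (absoluteGaloisGroup (w.adicCompletion ℚ) ⧸ layerGroup κ w (n + 1)) := layerFintypeQuot κ w (n + 1)
  letI : Fintype (absoluteGaloisGroup (w.adicCompletion ℚ) ⧸
      (κ.layerSubgroup (n + 1)).comap ((resGalOfEmb (closureEmb (K := ℚ) (w.adicCompletion ℚ)) :
        absoluteGaloisGroup (w.adicCompletion ℚ) →* absoluteGaloisGroup ℚ))) := layerFintypeQuot κ w (n + 1)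
  letI : Fintype (absoluteGaloisGroup (w.adicCompletion ℚ) ⧸
      (κ.layerSubgroup n).comap ((resGalOfEmb (closureEmb (K := ℚ) (w.adicCompletion ℚ)) :
        absoluteGaloisGroup (w.adicCompletion ℚ) →* absoluteGaloisGroup ℚ))) := layerFintypeQuot κ w n
  haveI : (layerGroup κ w (n + 1)).FiniteIndex := Subgroup.finiteIndex_of_finite_quotient
  haveI : Fintype (layerGroup κ w n ⧸ (layerGroup κ w (n + 1)).subgroupOf (layerGroup κ w n)) := Fintype.ofFinite _
  -- (i) the layer classes are trace-compatible (§3)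
  have hbb := coresLe_eq_of_characters S ρ ePk hμPk hadd₁Pk hadd₂Pk hgalPk hnondeg κ w n k χ b₁ b₀ hb₁ hb₀
  -- (ii) the Mackey components carry `P` to the local fibre sum (§2)
  have hcomp : ∀ c : Cosets κ w,
      cohomologyMap (resCoindFinHomR (cofreeTorsionGaloisModule S ρ ((2 ^ k : ℕ) : ℤ)).toTopRep (κ.layerSubgroup n)
          (resGalOfEmb (closureEmb (K := ℚ) (w.adicCompletion ℚ))) (c.out : absoluteGaloisGroup ℚ ⧸ κ.layerSubgroup n)) 1
          (cohomologyMap P 1 t₁) =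
        cohomologyMap (coindFinSum (localRepOf (cofreeTorsionGaloisModule S ρ ((2 ^ k : ℕ) : ℤ)) w)
            (SignedKatoOffTwo.LayerPairing.layerGroup_antitone κ w n)) 1
          (cohomologyMap (resCoindFinHomR (cofreeTorsionGaloisModule S ρ ((2 ^ k : ℕ) : ℤ)).toTopRep (κ.layerSubgroup (n + 1))
            (resGalOfEmb (closureEmb (K := ℚ) (w.adicCompletion ℚ))) (c.out : absoluteGaloisGroup ℚ ⧸ κ.layerSubgroup (n + 1))) 1
            t₁) := fun c => by
    have h1 := map_comp_apply_of (ContinuousMonoidHom.id _) (ContinuousMonoidHom.id _) (ContinuousMonoidHom.id _) (fun _ => rfl)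
      (resIdHom P)
      (resIdHom (resCoindFinHomR (cofreeTorsionGaloisModule S ρ ((2 ^ k : ℕ) : ℤ)).toTopRep (κ.layerSubgroup n)
        (resGalOfEmb (closureEmb (K := ℚ) (w.adicCompletion ℚ))) (c.out : absoluteGaloisGroup ℚ ⧸ κ.layerSubgroup n)))
      (resIdHom (P ≫ resCoindFinHomR (cofreeTorsionGaloisModule S ρ ((2 ^ k : ℕ) : ℤ)).toTopRep (κ.layerSubgroup n)
        (resGalOfEmb (closureEmb (K := ℚ) (w.adicCompletion ℚ))) (c.out : absoluteGaloisGroup ℚ ⧸ κ.layerSubgroup n)))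
      (fun _ => rfl) 1 t₁
    have h2 := map_comp_apply_of (ContinuousMonoidHom.id _) (ContinuousMonoidHom.id _) (ContinuousMonoidHom.id _) (fun _ => rfl)
      (resIdHom (resCoindFinHomR (cofreeTorsionGaloisModule S ρ ((2 ^ k : ℕ) : ℤ)).toTopRep (κ.layerSubgroup (n + 1))
        (resGalOfEmb (closureEmb (K := ℚ) (w.adicCompletion ℚ))) (c.out : absoluteGaloisGroup ℚ ⧸ κ.layerSubgroup (n + 1))))
      (resIdHom (coindFinSum (localRepOf (cofreeTorsionGaloisModule S ρ ((2 ^ k : ℕ) : ℤ)) w)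
        (SignedKatoOffTwo.LayerPairing.layerGroup_antitone κ w n)))
      (resIdHom (P ≫ resCoindFinHomR (cofreeTorsionGaloisModule S ρ ((2 ^ k : ℕ) : ℤ)).toTopRep (κ.layerSubgroup n)
        (resGalOfEmb (closureEmb (K := ℚ) (w.adicCompletion ℚ))) (c.out : absoluteGaloisGroup ℚ ⧸ κ.layerSubgroup n)))
      (fun F => funext fun x' => (hP F _).trans
        (resCoindFinHomR_coindFinSum κ hκ w hw hn (cofreeTorsionGaloisModule S ρ ((2 ^ k : ℕ) : ℤ)).toTopRep F c x')) 1 t₁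
    exact h1.symm.trans h2
  -- (iii) Shapiro carries the local fibre sum to the corestriction
  have hSh : ∀ c : Cosets κ w,
      cohomologyMap (coindFinSum (localRepOf (cofreeTorsionGaloisModule S ρ ((2 ^ k : ℕ) : ℤ)) w)
          (SignedKatoOffTwo.LayerPairing.layerGroup_antitone κ w n)) 1
          (layerShapiroOf (cofreeTorsionGaloisModule S ρ ((2 ^ k : ℕ) : ℤ)) κ w (n + 1) (b₁ c)) =
        layerShapiroOf (cofreeTorsionGaloisModule S ρ ((2 ^ k : ℕ) : ℤ)) κ w n
          (coresLe (localRepOf (cofreeTorsionGaloisModule S ρ ((2 ^ k : ℕ) : ℤ)) w) (SignedKatoOffTwo.LayerPairing.layerGroup_antitone κ w n)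
            (isOpen_layerGroup κ w (n + 1)) (b₁ c)) := fun c => by
    unfold layerShapiroOf
    exact cohomologyMap_coindFinSum_shapiroLift (localRepOf (cofreeTorsionGaloisModule S ρ ((2 ^ k : ℕ) : ℤ)) w)
      (SignedKatoOffTwo.LayerPairing.layerGroup_antitone κ w n) (isOpen_layerGroup κ w n) (isOpen_layerGroup κ w (n + 1))
      (layerReps_spec κ w n) (layerReps_one κ w n) (layerReps_spec κ w (n + 1)) (layerReps_one κ w (n + 1)) (b₁ c)
  -- (iv) components detect classes
  refine eq_of_forall_component_eq (cofreeTorsionGaloisModule S ρ ((2 ^ k : ℕ) : ℤ)).toTopRep (κ.layerSubgroup n)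
    (resGalOfEmb (closureEmb (K := ℚ) (w.adicCompletion ℚ)))
    (fun c : Cosets κ w => (c.out : absoluteGaloisGroup ℚ ⧸ κ.layerSubgroup n))
    (CosetFrame.bijective_cosets_out κ hκ w hw hn) _ _ fun c => ?_
  refine (hcomp c).trans ?_
  beta_reduce
  rw [hu₁ c, hu₀ c, hSh c, hbb c]

include hnondeg hκ hw in
set_option maxHeartbeats 1600000 in
/-- **(T2) `H¹(Σ|_w)(t₁) = t₀` for `n ≥ n_w`** — the hypothesis `hT2` of `AwayAssembly.exists_iwasawaH1_locdS_eq_of_towerCompat` (p704576) in its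
verbatim currency (Kato's trace `coindFinSum` on `Maps(Γ ⧸ Γ_{n+1}, A_ρ[2^k])`, restricted to `Γ_w`, as in p697362's `localization_shapiroLift_layerCores`),
under the splitting-level hypothesis `n_w ≤ n`. [cite: NeukirchSchmidtWingberg2008, I §5 (1.5.6)–(1.5.7), I §6 (1.6.4)] [cite: Kato2004Asterisque, §12.2 (p. 220)]
[cite: PerrinRiou1994Invent, §3.6.1] -/
theorem cohomologyMap_coindSum_eq_of_characters {n : ℕ} (hn : nfl w ≤ n) (k : ℕ) [Fintype (absoluteGaloisGroup ℚ ⧸ κ.layerSubgroup n)]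
    [Fintype (absoluteGaloisGroup ℚ ⧸ κ.layerSubgroup (n + 1))]
    [Finite ↥(AddSubgroup.torsionBy (Cofree ρ ↥(padicCoeffField S)) ((2 ^ k : ℕ) : ℤ))]
    (χ : Cosets κ w → CharacterModule (Dloc S κ ρ w))
    (b₁ : Cosets κ w → Dlev S κ ρ w (n + 1) k)
    (t₁ : galoisCohomology
      (((cofreeTorsionGaloisModule S ρ ((2 ^ k : ℕ) : ℤ)).coind (κ.layerSubgroup (n + 1)) (κ.isOpen_layerSubgroup (n + 1))).toLocal
        (Sum.inr w)) 1)
    (b₀ : Cosets κ w → Dlev S κ ρ w n k)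
    (t₀ : galoisCohomology
      (((cofreeTorsionGaloisModule S ρ ((2 ^ k : ℕ) : ℤ)).coind (κ.layerSubgroup n) (κ.isOpen_layerSubgroup n)).toLocal
        (Sum.inr w)) 1)
    (hb₁ : ∀ (c : Cosets κ w) (y : Dlev S κ ρ w (n + 1) k),
      χ c (jAway S κ ρ w (n + 1) k y) =
        (layerPairingH1Of (cofreeTorsionGaloisModule S ρ ((2 ^ k : ℕ) : ℤ)) (2 ^ k) (ePk k) (hμPk k) (hadd₁Pk k) (hadd₂Pk k) (hgalPk k)
            κ w (n + 1) (b₁ c) y).val • ((((2 : ℚ) ^ k)⁻¹ : ℚ) : AddCircle (1 : ℚ)))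
    (hu₁ : ∀ c : Cosets κ w,
      cohomologyMap (resCoindFinHomR (cofreeTorsionGaloisModule S ρ ((2 ^ k : ℕ) : ℤ)).toTopRep (κ.layerSubgroup (n + 1))
          (resGalOfEmb (closureEmb (K := ℚ) (w.adicCompletion ℚ)))
          (c.out : absoluteGaloisGroup ℚ ⧸ κ.layerSubgroup (n + 1))) 1 t₁ =
        layerShapiroOf (cofreeTorsionGaloisModule S ρ ((2 ^ k : ℕ) : ℤ)) κ w (n + 1) (b₁ c))
    (hb₀ : ∀ (c : Cosets κ w) (y : Dlev S κ ρ w n k),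
      χ c (jAway S κ ρ w n k y) =
        (layerPairingH1Of (cofreeTorsionGaloisModule S ρ ((2 ^ k : ℕ) : ℤ)) (2 ^ k) (ePk k) (hμPk k) (hadd₁Pk k) (hadd₂Pk k) (hgalPk k)
            κ w n (b₀ c) y).val • ((((2 : ℚ) ^ k)⁻¹ : ℚ) : AddCircle (1 : ℚ)))
    (hu₀ : ∀ c : Cosets κ w,
      cohomologyMap (resCoindFinHomR (cofreeTorsionGaloisModule S ρ ((2 ^ k : ℕ) : ℤ)).toTopRep (κ.layerSubgroup n)
          (resGalOfEmb (closureEmb (K := ℚ) (w.adicCompletion ℚ)))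
          (c.out : absoluteGaloisGroup ℚ ⧸ κ.layerSubgroup n)) 1 t₀ =
        layerShapiroOf (cofreeTorsionGaloisModule S ρ ((2 ^ k : ℕ) : ℤ)) κ w n (b₀ c)) :
    cohomologyMap (TopRep.ofHom ⟨(coindFinSum (cofreeTorsionGaloisModule S ρ ((2 ^ k : ℕ) : ℤ)).toTopRep
          (κ.layerSubgroup_antitone (Nat.le_succ n))).hom.toContinuousLinearMap, fun δ =>
        (coindFinSum (cofreeTorsionGaloisModule S ρ ((2 ^ k : ℕ) : ℤ)).toTopRep (κ.layerSubgroup_antitone (Nat.le_succ n))).hom.isIntertwining'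
          (resGalOfEmb (closureEmb (K := ℚ) (w.adicCompletion ℚ)) δ)⟩ :
      (((cofreeTorsionGaloisModule S ρ ((2 ^ k : ℕ) : ℤ)).coind (κ.layerSubgroup (n + 1)) (κ.isOpen_layerSubgroup (n + 1))).toLocal
          (Sum.inr w)).toTopRep ⟶
        (((cofreeTorsionGaloisModule S ρ ((2 ^ k : ℕ) : ℤ)).coind (κ.layerSubgroup n) (κ.isOpen_layerSubgroup n)).toLocal
          (Sum.inr w)).toTopRep) 1 t₁ = t₀ :=
  -- `P` is passed EXPLICITLY (not `_`): unifying `?P.hom F y` with `(coindFinSum …).hom F y` first would let the elaborator assign `?P` by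
  -- projection-eta to the GLOBAL intertwining map (a kernel type mismatch).
  cohomologyMap_eq_of_characters_of_sum S ρ ePk hμPk hadd₁Pk hadd₂Pk hgalPk hnondeg κ hκ w hw hn k χ
    (TopRep.ofHom ⟨(coindFinSum (cofreeTorsionGaloisModule S ρ ((2 ^ k : ℕ) : ℤ)).toTopRep
          (κ.layerSubgroup_antitone (Nat.le_succ n))).hom.toContinuousLinearMap, fun δ =>
        (coindFinSum (cofreeTorsionGaloisModule S ρ ((2 ^ k : ℕ) : ℤ)).toTopRep (κ.layerSubgroup_antitone (Nat.le_succ n))).hom.isIntertwining'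
          (resGalOfEmb (closureEmb (K := ℚ) (w.adicCompletion ℚ)) δ)⟩ :
      (((cofreeTorsionGaloisModule S ρ ((2 ^ k : ℕ) : ℤ)).coind (κ.layerSubgroup (n + 1)) (κ.isOpen_layerSubgroup (n + 1))).toLocal
          (Sum.inr w)).toTopRep ⟶
        (((cofreeTorsionGaloisModule S ρ ((2 ^ k : ℕ) : ℤ)).coind (κ.layerSubgroup n) (κ.isOpen_layerSubgroup n)).toLocal
          (Sum.inr w)).toTopRep)
    (fun _ _ => rfl) b₁ t₁ b₀ t₀ hb₁ hu₁ hb₀ hu₀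

end Two

end ThetaTransport.AwayTowerCores

end Summit.BirchSwinnertonDyer.BirchSwinnertonDyer.Theorems

end
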